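import Summits.QuantumFields.YangMills.Theorems.BalabanUVNodesN21AtSpineCarriersProfiledRealized

/-!
# YM-DAG node N21 (= NE7c), PROFILED ROAD: THRESHOLD SYNCHRONISATION BY THE CLAMP — with Lipschitz cut-off profiles a
# coupling-dependent threshold gap between the two runs is absorbed by RE-READING both runs' tested variables through the
# profile's clamp window in run A's units; pv07's one-threshold realized ledger (`T4LipschitzLedger.TermRepr` ∕ `SupClose`)
# then applies VERBATIM at the summed width `ρ + r`, and so does file 2's K5 knit `n21_knit_repr`

Track A of `YM-PLAN.md` (cell `pub-ymgap`, HUMAN RULING D-0062 ∕ D-0088), node **N21**; seat `pub-ymgap-dag-n21-e` (R141 (C), strategy s3 =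
ALTERNATIVE CURRENCY), generation 1, file 3 — companion of file 1 `…N21AtSpineCarriersProfiled` (p453165) and file 2 `…ProfiledRealized` (p454939).
Kernel bookkeeping: 0 `def`, 0 `sorry`, standard axioms.  COUNT-NEUTRAL; `--supports` the K3 item `SpineGivenEndpointR11` (stmt-QuantumFields-19676).

WHY (dag-n21-d's located finding (L1), `BalabanUVNodesN21SlotTestAtRecord` p452009 ∕ `…N21ThresholdSyncAtRecord` p455507).  The small-field
thresholds of record `ε(g_k)η²` ([Balaban1988Convergent] (2.4)∕(2.17)) are COUPLING-DEPENDENT, so at matched levels the two runs of the comparison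
test at DIFFERENT thresholds `θ^A = ε(g^A_j)η²`, `θ^B = ε(g^B_{j+1})η²`; their relative gap `r_j` is node U2's two-run coupling discrepancy read through the
profile `ε` (p455507 §3 `abs_epsOfRecord_runs_sub_le_of_u2Output`: geometrically thin in the level under `Spine.NE4.U2Output`) — an in-edge U2 ∕ N17 → N21.
p455507 §4 books it on ROAD I (sharp cut-offs) as a second width inside the displayed (M1) ledgers.  ON THE (η) ROAD the realized convention of pv07
(`TermRepr`: factor `i` of BOTH runs is read at ONE threshold `θ_i`; `SupClose`: `|u^A_i − u^B_i| ≤ ρ(K − a_i)·θ_i` a.e.) has no slot for two thresholds.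
THIS FILE shows none is needed: a Lipschitz cut-off profile `χ` (`= 1` on `(−∞, 1 − κ]`, `= 0` on `[1, ∞)`) sees its argument only through the CLAMP
to the window `[(1 − κ)θ, θ]`, so both runs' tested variables can be re-read through the clamp IN RUN A's UNITS —
`w^A := max((1−κ)θ^A, min(θ^A, u^A))`, `w^B := max((1−κ)θ^A, min(θ^A, (θ^A∕θ^B)·u^B))` — WITHOUT changing either run's factor (both polarities), and
the clamped pair is close at the SUMMED width: `|u^A − u^B| ≤ Δ`, `|θ^A − θ^B| ≤ r·θ^A` ⇒ `|w^A − w^B| ≤ Δ + r·θ^A`.  So pv07's ledger absorbs (L1)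
with NO new ledger lemma: `TermRepr` transports to the clamped variables, `SupClose` holds for them at width `ρ + r`, file 2's knit applies.

HONEST FRAMING.  NE7c is NOT PRINTED and NOT PROVED; (η) is a NON-PRINTED PROCEDURE of the sibling cell `pub-balaban` (`T4LipschitzCutoff` §4–§7);
`TermRepr` instantiation on Bałaban's terms = NODE O; (F∞) `SupClose` = node N16 (NOT PRINTED); the threshold-gap family `r` = node U2 ∕ N17 (0∕1,
NOT PRINTED — `U2Output` is a hypothesis wherever it appears); `SiblingSuppression` = NE7b species (node N20's lane) — AFTER synchronisation the displayed
sibling of a slot is built on the CLAMPED variable at width `ρ + r` (for a small-field slot: the term with its profile factor replaced by the slot's own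
sharp window `[(1−κ−ρ−r)θ^A, θ^A)` read on `w^A` — since `w^A ≥ (1−κ)θ^A` always, this is the term's own sharp small-field characteristic function
`1[u^A < θ^A]` whenever `ρ + r > 0`: Bałaban's ORIGINAL factor; its suppression constant is `≥ 1`, NE7b species as before, slightly coarser than the
shell-restricted sibling of the equal-threshold case).  Nothing of Bałaban's is asserted; one finite four-torus programme at fixed `ε`; NOT continuum ∕ ℝ⁴
∕ OS ∕ mass gap ∕ Clay.

CITATION HEADER (lean-in-tree rule 2026-08-18).  BY NAME from the tree: `T4LipschitzCutoff.LipProfile` (interface fields only), `T4LipschitzLedger`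
(`Pol.fac`, `facAt`, `TermRepr`, `SupClose`, `sibW`, `shellW`), `T4LipschitzCutoff` (`SiblingSuppression`, `lipWeight`), file 2's `n21_knit_repr` ∕
`s_N21_of_reprReading`, Mathlib (`abs_max_sub_max_le_max`, `abs_min_sub_min_le_max`, `Measurable.max ∕ .min`).  SUPPLIER CITED, not retyped:
dag-n21-d's p455507 §3–§4 (the U2-side size of `r_j`).  Context only (SHAPE): [Balaban1988Convergent] (2.4) p. 255 `ε_k = g_k A₀ (log g_k⁻²)^{p₀}`,
(2.17) p. 257.  No printed sentence is a hypothesis of any declaration.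

WHAT IS PROVED ([folklore]).
§1 POINTWISE: `abs_clamp_sub_clamp_le` (the clamp is 1-Lipschitz); `profile_clamp_div_eq`, `profile_clamp_rescaled_div_eq` (the factor is unchanged by
  the clamp re-reading, plain and rescaled); `facAt_clamp_eq`, `facAt_clamp_rescaled_eq` (both polarities, pv07's `facAt`); `abs_clamp_sub_clamp_rescaled_le`
  (`≤ Δ + r·θ^A`) and `…_rel` (`Δ = ρθ^A` ⇒ `≤ (ρ + r)·θ^A`).
§2 REALIZED TRANSPORT: `termRepr_syncA`, `termRepr_syncB` (pv07's `TermRepr` for the clamped variables at run A's thresholds, from each run's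
  representation AT ITS OWN thresholds), `supClose_sync` (`SupClose` at width `ρ + r`), `n21_knit_repr_twoThresholds` (file 2's knit on the synchronised
  data ⇒ `ShellWeightBound l₀ T A B shA shB Wsh`).
§3 AT THE SPINE CARRIERS: `s_N21_of_twoThresholdReprReading` (`S_N21 SRec` for every record predicate handing the two runs represented at their OWN
  thresholds, (F∞) at run A's thresholds, the threshold-gap family, sibling suppression on the clamped siblings, and the pinning of the shell parts).
VACUITY GUARD (audit A1–A6): the companion `BalabanUVNodesN21ProfiledThresholdSyncSanity` inhabits the §3 reading with GENUINELY DIFFERENT thresholds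
  (pv07's §5 toy with run B re-thresholded at `1 + (1∕2)^K∕8 ≠ 1`) at a non-degenerate bundle and fires `S_N21` on it.
-/

set_option autoImplicit false

noncomputable section

open scoped BigOperators
open MeasureTheory

namespace Summit.QuantumFields.YangMills.Theorems.N21ProfiledThresholdSync

open Literature.MathematicalPhysics.QuantumFieldTheory.Balaban1983to89
open T4IndicatorShell (ShellWeightBound)
open T4LipschitzCutoff (LipProfile SiblingSuppression lipWeight)
open T4LipschitzLedger (Pol facAt TermRepr SupClose sibW shellW)
open YMDAG.UVSplit (SpineCarriers SpineRecordPred S_N21)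
open N21AtSpineCarriersProfiledRealized (n21_knit_repr)
open Finset

/-! ## §1 Pointwise: the clamp re-reading leaves the factors unchanged and is close at the summed width -/

section Pointwise

/-- The clamp `x ↦ max l (min h x)` is 1-Lipschitz. [folklore] -/
theorem abs_clamp_sub_clamp_le (l h x y : ℝ) : |max l (min h x) - max l (min h y)| ≤ |x - y| :=
  calc |max l (min h x) - max l (min h y)| ≤ max |l - l| |min h x - min h y| := abs_max_sub_max_le_max _ _ _ _
    _ ≤ max |l - l| (max |h - h| |x - y|) := max_le_max le_rfl (abs_min_sub_min_le_max _ _ _ _)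
    _ = |x - y| := by
        rw [sub_self, sub_self, abs_zero, max_eq_right (abs_nonneg (x - y)), max_eq_right (abs_nonneg (x - y))]

variable {χ : ℝ → ℝ} {κ L : ℝ}

/-- **THE FACTOR SEES ONLY THE CLAMP.**  For a Lipschitz cut-off profile (`χ = 1` on `(−∞, 1−κ]`, `χ = 0` on `[1, ∞)`) and `θ > 0`:
`χ(max((1−κ)θ, min(θ, u))∕θ) = χ(u∕θ)` — below the window both sides are `1`, above it both are `0`, inside it the clamp is the identity.
[folklore] -/
theorem profile_clamp_div_eq (hχ : LipProfile χ κ L) {θ : ℝ} (hθ : 0 < θ) (u : ℝ) :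
    χ (max ((1 - κ) * θ) (min θ u) / θ) = χ (u / θ) := by
  have hl : (1 - κ) * θ ≤ θ := by nlinarith [hχ.kappa_pos]
  by_cases h1 : u ≤ (1 - κ) * θ
  · -- below the window: both factors equal `1`
    rw [min_eq_right (h1.trans hl), max_eq_left h1, hχ.eq_one _ (by rw [mul_div_assoc, div_self hθ.ne', mul_one]),
      hχ.eq_one _ (by rwa [div_le_iff₀ hθ])]
  · by_cases h2 : θ ≤ u
    · -- above the window: both factors vanish
      rw [min_eq_left h2, max_eq_right hl, div_self hθ.ne', hχ.eq_zero _ le_rfl,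
        hχ.eq_zero _ (by rwa [le_div_iff₀ hθ, one_mul])]
    · -- inside the window: the clamp is the identity
      rw [min_eq_right (not_le.1 h2).le, max_eq_right (not_le.1 h1).le]

/-- **… AND THE RESCALED CLAMP READS RUN B's FACTOR AT RUN A's THRESHOLD:** `χ(max((1−κ)θ^A, min(θ^A, (θ^A∕θ^B)·u))∕θ^A) = χ(u∕θ^B)`. [folklore] -/
theorem profile_clamp_rescaled_div_eq (hχ : LipProfile χ κ L) {θA θB : ℝ} (hθA : 0 < θA) (hθB : 0 < θB) (u : ℝ) :
    χ (max ((1 - κ) * θA) (min θA (θA / θB * u)) / θA) = χ (u / θB) := by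
  rw [profile_clamp_div_eq hχ hθA]
  congr 1
  field_simp

/-- Both polarities of pv07's slot factor are functions of the profile value, hence unchanged by the clamp re-reading (plain form).
[folklore] -/
theorem facAt_clamp_eq {χs : ℕ → ℝ → ℝ} {κs Ls : ℕ → ℝ} (hχ : ∀ a, LipProfile (χs a) (κs a) (Ls a)) {sl : ℕ → Σ _ : ℕ, ℕ}
    {pol : ℕ → Pol} {θ u : ℕ → ℝ} {i : ℕ} (hθ : 0 < θ i) :
    facAt χs sl pol θ (fun j => max ((1 - κs (sl j).1) * θ j) (min (θ j) (u j))) i = facAt χs sl pol θ u i := by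
  unfold facAt
  rw [profile_clamp_div_eq (hχ _) hθ]

/-- … and (rescaled form) the clamp in run A's units reproduces run B's factor at run B's threshold. [folklore] -/
theorem facAt_clamp_rescaled_eq {χs : ℕ → ℝ → ℝ} {κs Ls : ℕ → ℝ} (hχ : ∀ a, LipProfile (χs a) (κs a) (Ls a)) {sl : ℕ → Σ _ : ℕ, ℕ}
    {pol : ℕ → Pol} {θA θB u : ℕ → ℝ} {i : ℕ} (hθA : 0 < θA i) (hθB : 0 < θB i) :
    facAt χs sl pol θA (fun j => max ((1 - κs (sl j).1) * θA j) (min (θA j) (θA j / θB j * u j))) i = facAt χs sl pol θB u i := by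
  unfold facAt
  rw [profile_clamp_rescaled_div_eq (hχ _) hθA hθB]

/-- **THE CLAMPED PAIR IS CLOSE AT THE SUMMED WIDTH.**  For `0 ≤ κ ≤ 1`, `θ^A, θ^B > 0`, a threshold gap `|θ^A − θ^B| ≤ r·θ^A` and a two-run distance
`|u^A − u^B| ≤ Δ`: `|max((1−κ)θ^A, min(θ^A, u^A)) − max((1−κ)θ^A, min(θ^A, (θ^A∕θ^B)·u^B))| ≤ Δ + r·θ^A`.  Three cases on run B's own window: for
`u^B ≥ θ^B` the rescaled clamp is pinned at `θ^A` and `u^A ≥ θ^B − Δ ≥ θ^A − rθ^A − Δ`; for `u^B ≤ (1−κ)θ^B` it is pinned at `(1−κ)θ^A` and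
`u^A ≤ (1−κ)θ^B + Δ ≤ (1−κ)θ^A + rθ^A + Δ`; inside the window `0 < u^B < θ^B`, the clamp is 1-Lipschitz and the rescaling costs
`u^B·|θ^B − θ^A|∕θ^B ≤ |θ^A − θ^B|`. [folklore] -/
theorem abs_clamp_sub_clamp_rescaled_le {θA θB uA uB Δ r : ℝ} (hκ0 : 0 ≤ κ) (hκ1 : κ ≤ 1) (hθA : 0 < θA) (hθB : 0 < θB)
    (hθ : |θA - θB| ≤ r * θA) (hΔ : |uA - uB| ≤ Δ) :
    |max ((1 - κ) * θA) (min θA uA) - max ((1 - κ) * θA) (min θA (θA / θB * uB))| ≤ Δ + r * θA := by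
  have hΔ0 : 0 ≤ Δ := (abs_nonneg _).trans hΔ
  have hr0 : 0 ≤ r * θA := (abs_nonneg _).trans hθ
  obtain ⟨hΔ1, hΔ2⟩ := abs_le.1 hΔ
  obtain ⟨hθ1, hθ2⟩ := abs_le.1 hθ
  have hl : (1 - κ) * θA ≤ θA := by nlinarith
  -- elementary facts about run A's clamp
  have cA_le : max ((1 - κ) * θA) (min θA uA) ≤ θA := max_le hl (min_le_left _ _)
  have cA_ge : (1 - κ) * θA ≤ max ((1 - κ) * θA) (min θA uA) := le_max_left _ _
  have cA_ge' : min θA uA ≤ max ((1 - κ) * θA) (min θA uA) := le_max_right _ _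
  have cA_le' : max ((1 - κ) * θA) (min θA uA) ≤ max ((1 - κ) * θA) uA := max_le_max le_rfl (min_le_right _ _)
  have e_resc : θA / θB * uB = θA * (uB / θB) := by ring
  rcases le_or_gt θB uB with h1 | h1
  · -- (i) run B at or above its threshold: the rescaled clamp is pinned at `θA`
    have hge : θA ≤ θA / θB * uB := by
      rw [e_resc]; exact le_mul_of_one_le_right hθA.le ((one_le_div hθB).2 h1)
    rw [min_eq_left hge, max_eq_right hl, abs_sub_comm, abs_of_nonneg (sub_nonneg.2 cA_le)]
    -- `θA − clamp(uA) ≤ Δ + rθA` because `min θA uA ≥ θA − rθA − Δ`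
    have : θA - (Δ + r * θA) ≤ min θA uA := le_min (by linarith) (by linarith)
    linarith
  · rcases le_or_gt uB ((1 - κ) * θB) with h2 | h2
    · -- (ii) run B at or below its plateau edge: the rescaled clamp is pinned at `(1−κ)θA`
      have hle : θA / θB * uB ≤ (1 - κ) * θA := by
        rw [e_resc]
        have : uB / θB ≤ 1 - κ := by rw [div_le_iff₀ hθB]; linarith
        nlinarith
      rw [min_eq_right (hle.trans hl), max_eq_left hle, abs_of_nonneg (sub_nonneg.2 cA_ge)]
      -- `clamp(uA) − (1−κ)θA ≤ Δ + rθA` because `uA ≤ (1−κ)θB + Δ ≤ (1−κ)θA + rθA + Δ`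
      have hu : uA ≤ (1 - κ) * θA + (Δ + r * θA) := by nlinarith
      have : max ((1 - κ) * θA) uA ≤ (1 - κ) * θA + (Δ + r * θA) := max_le (by linarith) hu
      linarith
    · -- (iii) run B strictly inside its window `((1−κ)θB, θB)`: 1-Lipschitz clamp + the rescaling cost
      have hB0 : 0 < uB := lt_of_le_of_lt (by nlinarith) h2
      refine (abs_clamp_sub_clamp_le _ _ _ _).trans ?_
      have hsplit : |uA - θA / θB * uB| ≤ |uA - uB| + |uB - θA / θB * uB| := abs_sub_le _ _ _
      have hresc : |uB - θA / θB * uB| ≤ r * θA := by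
        have e : uB - θA / θB * uB = uB / θB * (θB - θA) := by field_simp
        rw [e, abs_mul, abs_of_pos (div_pos hB0 hθB)]
        have hq : uB / θB ≤ 1 := (div_le_one hθB).2 h1.le
        have hBA : |θB - θA| ≤ r * θA := by rwa [abs_sub_comm]
        calc uB / θB * |θB - θA| ≤ 1 * |θB - θA| :=
              mul_le_mul_of_nonneg_right hq (abs_nonneg _)
          _ ≤ r * θA := by rw [one_mul]; exact hBA
      linarith

/-- Relative form: `Δ = ρ·θ^A` ⇒ the clamped pair is `(ρ + r)·θ^A`-close. [folklore] -/
theorem abs_clamp_sub_clamp_rescaled_le_rel {θA θB uA uB ρ r : ℝ} (hκ0 : 0 ≤ κ) (hκ1 : κ ≤ 1) (hθA : 0 < θA) (hθB : 0 < θB)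
    (hθ : |θA - θB| ≤ r * θA) (hΔ : |uA - uB| ≤ ρ * θA) :
    |max ((1 - κ) * θA) (min θA uA) - max ((1 - κ) * θA) (min θA (θA / θB * uB))| ≤ (ρ + r) * θA := by
  have h := abs_clamp_sub_clamp_rescaled_le hκ0 hκ1 hθA hθB hθ hΔ
  linarith

end Pointwise

/-! ## §2 Realized transport: pv07's one-threshold ledger for the clamped variables, at the summed width -/

section Realized

variable {ι : Type*} {Ω : ℕ → ι → Type*} [∀ K τ, MeasurableSpace (Ω K τ)]
  {l₀ : ℝ} {T : ℕ → Finset ι} {A B shA shB : ℕ → ℝ → ι → ℝ} {χ : ℕ → ℝ → ℝ} {κ Lχ : ℕ → ℝ} {N : ℕ} {n : ℕ → ℕ}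
  {μ : (K : ℕ) → (τ : ι) → Measure (Ω K τ)} {m : ℕ → ι → ℕ} {slot : ℕ → ι → ℕ → Σ _ : ℕ, ℕ}
  {pol : ℕ → ι → ℕ → Pol} {θA θB : ℕ → ι → ℕ → ℝ} {uA uB : (K : ℕ) → (τ : ι) → ℕ → Ω K τ → ℝ}
  {RA RB : (K : ℕ) → ℝ → (τ : ι) → Ω K τ → ℝ} {ρ r S : ℕ → ℝ}

/-- **RUN A RE-READ THROUGH THE CLAMP.**  Run A represented at its own thresholds `θ^A` (pv07's `TermRepr`, run B's variables in the second slot) ⇒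
represented with BOTH runs' variables clamped in run A's units (`w^A`, `w^B` as in §1): the integrand is unchanged factor by factor
(`facAt_clamp_eq`), the clamped variables are measurable. [folklore] -/
theorem termRepr_syncA (hA : TermRepr l₀ T A χ κ Lχ N n μ m slot pol θA uA uB RA) :
    TermRepr l₀ T A χ κ Lχ N n μ m slot pol θA
      (fun K τ i v => max ((1 - κ (slot K τ i).1) * θA K τ i) (min (θA K τ i) (uA K τ i v)))
      (fun K τ i v => max ((1 - κ (slot K τ i).1) * θA K τ i) (min (θA K τ i) (θA K τ i / θB K τ i * uB K τ i v))) RA where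
  profile := hA.profile
  thr_pos := hA.thr_pos
  slot_mem := hA.slot_mem
  slot_band := hA.slot_band
  meas K τ hτ i hi :=
    ⟨measurable_const.max (measurable_const.min (hA.meas K τ hτ i hi).1),
      measurable_const.max (measurable_const.min ((hA.meas K τ hτ i hi).2.const_mul _))⟩
  rem_nonneg := hA.rem_nonneg
  rem_int := hA.rem_int
  repr K t ht τ hτ := by
    rw [hA.repr K t ht τ hτ]
    refine integral_congr_ae (Filter.Eventually.of_forall fun _ => ?_)
    simp only
    congr 1
    exact prod_congr rfl fun i hi => (facAt_clamp_eq hA.profile (hA.thr_pos K τ hτ i (mem_range.1 hi))).symm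

/-- **RUN B RE-READ THROUGH THE RESCALED CLAMP, AT RUN A's THRESHOLDS.**  Run B represented at ITS OWN thresholds `θ^B` ⇒ represented at run A's
thresholds `θ^A > 0` with the clamped variables (`facAt_clamp_rescaled_eq`: `χ(w^B∕θ^A) = χ(u^B∕θ^B)` factor by factor). [folklore] -/
theorem termRepr_syncB (hB : TermRepr l₀ T B χ κ Lχ N n μ m slot pol θB uB uA RB)
    (hθA : ∀ K, ∀ τ ∈ T K, ∀ i < m K τ, 0 < θA K τ i) :
    TermRepr l₀ T B χ κ Lχ N n μ m slot pol θA
      (fun K τ i v => max ((1 - κ (slot K τ i).1) * θA K τ i) (min (θA K τ i) (θA K τ i / θB K τ i * uB K τ i v)))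
      (fun K τ i v => max ((1 - κ (slot K τ i).1) * θA K τ i) (min (θA K τ i) (uA K τ i v))) RB where
  profile := hB.profile
  thr_pos := hθA
  slot_mem := hB.slot_mem
  slot_band := hB.slot_band
  meas K τ hτ i hi :=
    ⟨measurable_const.max (measurable_const.min ((hB.meas K τ hτ i hi).1.const_mul _)),
      measurable_const.max (measurable_const.min (hB.meas K τ hτ i hi).2)⟩
  rem_nonneg := hB.rem_nonneg
  rem_int := hB.rem_int
  repr K t ht τ hτ := by
    rw [hB.repr K t ht τ hτ]
    refine integral_congr_ae (Filter.Eventually.of_forall fun _ => ?_)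
    simp only
    congr 1
    exact prod_congr rfl fun i hi =>
      (facAt_clamp_rescaled_eq hB.profile (hθA K τ hτ i (mem_range.1 hi)) (hB.thr_pos K τ hτ i (mem_range.1 hi))).symm

/-- **(F∞) FOR THE CLAMPED PAIR AT THE SUMMED WIDTH.**  `SupClose` at run A's thresholds with width `ρ` (node N16) and a threshold gap
`|θ^A_i − θ^B_i| ≤ r(K − a_i)·θ^A_i` by LEVEL (node U2 ∕ N17, via the profile of record — dag-n21-d p455507 §3) ⇒ `SupClose` for the clamped pair
at width `ρ + r` (`abs_clamp_sub_clamp_rescaled_le_rel`, a.e.). [folklore] -/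
theorem supClose_sync (hχ : ∀ a, LipProfile (χ a) (κ a) (Lχ a))
    (hθA : ∀ K, ∀ τ ∈ T K, ∀ i < m K τ, 0 < θA K τ i) (hθB : ∀ K, ∀ τ ∈ T K, ∀ i < m K τ, 0 < θB K τ i)
    (hF : SupClose T μ m slot θA uA uB ρ)
    (hθ : ∀ K, ∀ τ ∈ T K, ∀ i < m K τ, |θA K τ i - θB K τ i| ≤ r (K - (slot K τ i).1) * θA K τ i) :
    SupClose T μ m slot θA
      (fun K τ i v => max ((1 - κ (slot K τ i).1) * θA K τ i) (min (θA K τ i) (uA K τ i v)))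
      (fun K τ i v => max ((1 - κ (slot K τ i).1) * θA K τ i) (min (θA K τ i) (θA K τ i / θB K τ i * uB K τ i v)))
      (fun j => ρ j + r j) := fun K τ hτ i hi =>
  (hF K τ hτ i hi).mono fun _ hv =>
    abs_clamp_sub_clamp_rescaled_le_rel (hχ _).kappa_pos.le (hχ _).kappa_lt_one.le (hθA K τ hτ i hi) (hθB K τ hτ i hi)
      (hθ K τ hτ i hi) hv

/-- **N21 KNIT, PROFILED ROAD, TWO THRESHOLD FAMILIES.**  At explicit carriers `(l₀, T, A, B, shA, shB)`: the two runs represented AT THEIR OWN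
thresholds `θ^A`, `θ^B` (pv07's `TermRepr`), (F∞) at run A's thresholds with width `ρ` (node N16), the threshold gap `r` by level (node U2 ∕ N17),
`SiblingSuppression` of the CLAMPED siblings at width `ρ + r` in both runs (NE7b species), signs and summability of `ρ`, `r`, and the shell parts PINNED as the
realized shell parts of the clamped pair ⇒ `ShellWeightBound l₀ T A B shA shB Wsh` for every summable `Wsh ≥ Σ_{a≤N} n_a·lipWeight Lχ S (ρ + r) a K` —
file 2's `n21_knit_repr` on the synchronised data of `termRepr_syncA ∕ _syncB ∕ supClose_sync`.  CONDITIONAL on every displayed binder; NE7c NOT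
proved. [folklore] -/
theorem n21_knit_repr_twoThresholds (hA : TermRepr l₀ T A χ κ Lχ N n μ m slot pol θA uA uB RA)
    (hB : TermRepr l₀ T B χ κ Lχ N n μ m slot pol θB uB uA RB) (hF : SupClose T μ m slot θA uA uB ρ)
    (hθ : ∀ K, ∀ τ ∈ T K, ∀ i < m K τ, |θA K τ i - θB K τ i| ≤ r (K - (slot K τ i).1) * θA K τ i)
    (hSA : SiblingSuppression l₀ T A N n
      (sibW χ κ μ m slot pol θA (fun K τ i v => max ((1 - κ (slot K τ i).1) * θA K τ i) (min (θA K τ i) (uA K τ i v))) RA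
        fun j => ρ j + r j) S)
    (hSB : SiblingSuppression l₀ T B N n
      (sibW χ κ μ m slot pol θA
        (fun K τ i v => max ((1 - κ (slot K τ i).1) * θA K τ i) (min (θA K τ i) (θA K τ i / θB K τ i * uB K τ i v))) RB
        fun j => ρ j + r j) S)
    (hS : ∀ a ≤ N, 0 ≤ S a) (hρ0 : ∀ j, 0 ≤ ρ j) (hr0 : ∀ j, 0 ≤ r j) (hρ : Summable ρ) (hr : Summable r)
    (hshA : shA = shellW χ μ m slot pol θA
      (fun K τ i v => max ((1 - κ (slot K τ i).1) * θA K τ i) (min (θA K τ i) (uA K τ i v)))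
      (fun K τ i v => max ((1 - κ (slot K τ i).1) * θA K τ i) (min (θA K τ i) (θA K τ i / θB K τ i * uB K τ i v))) RA)
    (hshB : shB = shellW χ μ m slot pol θA
      (fun K τ i v => max ((1 - κ (slot K τ i).1) * θA K τ i) (min (θA K τ i) (θA K τ i / θB K τ i * uB K τ i v)))
      (fun K τ i v => max ((1 - κ (slot K τ i).1) * θA K τ i) (min (θA K τ i) (uA K τ i v))) RB)
    {Wsh : ℕ → ℝ} (hWsh : ∀ K, ∑ a ∈ range (N + 1), (n a : ℝ) * lipWeight Lχ S (fun j => ρ j + r j) a K ≤ Wsh K)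
    (hsum : Summable Wsh) : ShellWeightBound l₀ T A B shA shB Wsh :=
  n21_knit_repr (termRepr_syncA hA) (termRepr_syncB hB hA.thr_pos)
    (supClose_sync hA.profile hA.thr_pos hB.thr_pos hF hθ) hSA hSB hS (fun j => add_nonneg (hρ0 j) (hr0 j)) (hρ.add hr)
    hshA hshB hWsh hsum

end Realized

/-! ## §3 At the spine carriers: `S_N21 SRec` for every two-threshold realized reading -/

section AtCarriers

variable {N : ℕ} [NeZero N]

/-- **`S_N21` FOR EVERY TWO-THRESHOLD REALIZED (η) READING.**  If the carrier predicate `SRec` hands, with every bundle `S` it pins, per-term spaces and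
measures, profiles, a window with counts, factor data `(m, slot, pol)`, TWO threshold families `θ^A`, `θ^B`, the two runs' tested variables and remainders,
a width `ρ`, a threshold-gap family `r` and sibling constants `Ssup` such that: run A is represented at `θ^A` and run B at `θ^B` (`TermRepr`), (F∞)
`SupClose … θ^A u^A u^B ρ`, `|θ^A_i − θ^B_i| ≤ r(K − a_i)·θ^A_i`, `SiblingSuppression` of the clamped siblings at width `ρ + r` in both runs, `0 ≤ Ssup`,
`0 ≤ ρ, r` summable, the shell parts pinned as the realized shell parts of the clamped pair, and `S.Wsh` summable dominating the band weight at width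
`ρ + r` — then `S_N21 SRec` (§2's `n21_knit_repr_twoThresholds`). [folklore] -/
theorem s_N21_of_twoThresholdReprReading (SRec : SpineRecordPred N)
    (hread : ∀ (F : T4Continuum.T4Family) (D : YMDAG.UVSplit.Datum F N) (g₀ : ℕ → ℝ)
      (os : List (T4Continuum.ULoop F)) (S : SpineCarriers), SRec F D g₀ os S →
      ∃ (Ω : ℕ → S.ι → Type) (_mΩ : ∀ K τ, MeasurableSpace (Ω K τ)) (μ : (K : ℕ) → (τ : S.ι) → Measure (Ω K τ))
        (χ : ℕ → ℝ → ℝ) (κ Lχ : ℕ → ℝ) (Nw : ℕ) (n : ℕ → ℕ) (m : ℕ → S.ι → ℕ) (slot : ℕ → S.ι → ℕ → Σ _ : ℕ, ℕ)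
        (pol : ℕ → S.ι → ℕ → Pol) (θA θB : ℕ → S.ι → ℕ → ℝ) (uA uB : (K : ℕ) → (τ : S.ι) → ℕ → Ω K τ → ℝ)
        (RA RB : (K : ℕ) → ℝ → (τ : S.ι) → Ω K τ → ℝ) (ρ r Ssup : ℕ → ℝ),
        TermRepr S.l₀ S.T S.A χ κ Lχ Nw n μ m slot pol θA uA uB RA ∧ TermRepr S.l₀ S.T S.B χ κ Lχ Nw n μ m slot pol θB uB uA RB ∧
        SupClose S.T μ m slot θA uA uB ρ ∧
        (∀ K, ∀ τ ∈ S.T K, ∀ i < m K τ, |θA K τ i - θB K τ i| ≤ r (K - (slot K τ i).1) * θA K τ i) ∧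
        SiblingSuppression S.l₀ S.T S.A Nw n
          (sibW χ κ μ m slot pol θA (fun K τ i v => max ((1 - κ (slot K τ i).1) * θA K τ i) (min (θA K τ i) (uA K τ i v))) RA
            fun j => ρ j + r j) Ssup ∧
        SiblingSuppression S.l₀ S.T S.B Nw n
          (sibW χ κ μ m slot pol θA
            (fun K τ i v => max ((1 - κ (slot K τ i).1) * θA K τ i) (min (θA K τ i) (θA K τ i / θB K τ i * uB K τ i v))) RB
            fun j => ρ j + r j) Ssup ∧
        (∀ a ≤ Nw, 0 ≤ Ssup a) ∧ (∀ j, 0 ≤ ρ j) ∧ (∀ j, 0 ≤ r j) ∧ Summable ρ ∧ Summable r ∧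
        S.shA = shellW χ μ m slot pol θA
          (fun K τ i v => max ((1 - κ (slot K τ i).1) * θA K τ i) (min (θA K τ i) (uA K τ i v)))
          (fun K τ i v => max ((1 - κ (slot K τ i).1) * θA K τ i) (min (θA K τ i) (θA K τ i / θB K τ i * uB K τ i v))) RA ∧
        S.shB = shellW χ μ m slot pol θA
          (fun K τ i v => max ((1 - κ (slot K τ i).1) * θA K τ i) (min (θA K τ i) (θA K τ i / θB K τ i * uB K τ i v)))
          (fun K τ i v => max ((1 - κ (slot K τ i).1) * θA K τ i) (min (θA K τ i) (uA K τ i v))) RB ∧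
        (∀ K, ∑ a ∈ range (Nw + 1), (n a : ℝ) * lipWeight Lχ Ssup (fun j => ρ j + r j) a K ≤ S.Wsh K) ∧ Summable S.Wsh) :
    S_N21 SRec := by
  intro F D g₀ os S hS
  obtain ⟨Ω, mΩ, μ, χ, κ, Lχ, Nw, n, m, slot, pol, θA, θB, uA, uB, RA, RB, ρ, r, Ssup, hA, hB, hF, hθ, hSA, hSB, hS0, hρ0, hr0,
    hρ, hr, hshA, hshB, hWsh, hsum⟩ := hread F D g₀ os S hS
  exact n21_knit_repr_twoThresholds hA hB hF hθ hSA hSB hS0 hρ0 hr0 hρ hr hshA hshB hWsh hsum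

end AtCarriers

end Summit.QuantumFields.YangMills.Theorems.N21ProfiledThresholdSync

end
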